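import Literature.NumberTheory.GaloisRepresentations.CyclicNormLayer
import Literature.NumberTheory.GaloisRepresentations.SubgroupInclusions
import Literature.NumberTheory.GaloisRepresentations.ShapiroInjective
import Literature.NumberTheory.GaloisRepresentations.LocalConstancy
import Literature.NumberTheory.GaloisRepresentations.PGroupDescent
import HarnessLib

/-!
# `H²(Gal(K̄/F), μ_p) = 0` under norm surjectivity (Serre II §3.1 Prop. 5, (iv) bis ⇒ (ii) ⇒ (i))

Let `k` be a field such that for every finite separable `K/k` and finite Galois `L/K` the norm
`N_{L/K} : L → K` is onto (hypothesis (iv) bis of Serre, *Cohomologie galoisienne* II §3.1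
Prop. 5), and let `p` be a prime.  For every **open** subgroup `H ≤ Γ_k` (i.e. `H = Gal(K̄/F)`,
`F/k` finite separable):

* `exists_d_eq_of_units_cocycle` — a continuous `2`-cocycle `a` of `H` with values in `K̄ˣ` and
  `p · a = 0` is a coboundary ("the `p`-primary part of `Br(F)` vanishes", (iv) bis ⇒ (ii)).
  Proof: `a` dies on `Gal(K̄/L₁)` for a finite Galois `L₁/k` (local constancy,
  `exists_nhds_one_res_two_eq_d`); with `A = H|_{L₁} ≤ Gal(L₁/k)` and a Sylow `p`-subgroup
  `P ≤ A`, it suffices that `a` dies on `Gal(K̄/L₁^P)` (index prime to `p`,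
  `exists_d_eq_of_res_eq_d_of_psmul_eq_zero`), which follows by descending the cyclic tower of
  the `p`-group `P` (`IsPGroup.subgroup_induction`) with the layer lemma `exists_d_eq_of_layer`
  (Hilbert 90 + `H²` of a cyclic layer = invariants mod norms = 0).
* `subsingleton_two_mu_of_norm_surjective` — `H²(H, μ_p) = 0` ((ii) ⇒ (i) for the module `μ_p`):
  the Kummer sequence and Hilbert 90 (`IsSES.exists_d_eq_of_map_two`).

## References

* J.-P. Serre, *Cohomologie galoisienne* (1997), II §3.1 Prop. 5; I §3.3 Prop. 14, Cor. 1;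
  II §1.2. [SerreGaloisCohomology1997]
* J.-P. Serre, *Corps locaux* (1968), X §7 Prop. 11. [SerreLocalFields1979]
-/

noncomputable section

open CategoryTheory Topology Filter Field IntermediateField

universe u

namespace Literature.NumberTheory.GaloisRepresentations

open _root_.TopRep _root_.ContRepresentation _root_.ContinuousCohomology DiscreteGaloisModule
  LocalWeilDatum

set_option allowUnsafeReducibility true in
attribute [local reducible] CategoryTheory.Functor.mapHomologicalComplex

attribute [local instance] compactSpace_of_isClosed_subgroup

variable {k : Type u} [Field k]

/-- **Open subgroups of `Γ_k` are fixing subgroups of finite subextensions**: `H = Gal(K̄/F)`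
with `F = L₁^{H|_{L₁}}` for any finite Galois `L₁/k` with `Gal(K̄/L₁) ≤ H`. [folklore] -/
theorem exists_galFixing_eq_of_isOpen (H : Subgroup (absoluteGaloisGroup k))
    (hH : IsOpen (H : Set (absoluteGaloisGroup k))) :
    ∃ F : IntermediateField k (AlgebraicClosure k), FiniteDimensional k F ∧ galFixing k F = H := by
  obtain ⟨L₁, hfin, hgal, hL₁⟩ :=
    exists_finiteDimensional_isGalois_galFixing_subset (k := k) (hH.mem_nhds H.one_mem)
  haveI := hfin
  haveI := hgal
  refine ⟨lift (fixedField (H.map (resGal L₁))),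
    (liftAlgEquiv (fixedField (H.map (resGal L₁)))).toLinearEquiv.finiteDimensional, ?_⟩
  rw [galFixing_lift_fixedField]
  exact Subgroup.comap_map_eq_self (by rw [ker_resGal]; exact hL₁)

/-- Normality passes along `Subgroup.map`, relative version. [folklore] -/
theorem normal_subgroupOf_map {G G' : Type*} [Group G] [Group G'] (f : G →* G')
    {C C' : Subgroup G} (hC'C : C' ≤ C) (hn : (C'.subgroupOf C).Normal) :
    ((C'.map f).subgroupOf (C.map f)).Normal := by
  refine ⟨fun x hx y => ?_⟩
  rw [Subgroup.mem_subgroupOf, Subgroup.mem_map] at hx ⊢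
  obtain ⟨c', hc', hc'x⟩ := hx
  obtain ⟨c, hc, hcy⟩ := (Subgroup.mem_map.1 y.2)
  have h := hn.conj_mem ⟨c', hC'C hc'⟩ hc' ⟨c, hc⟩
  rw [Subgroup.mem_subgroupOf] at h
  refine ⟨c * c' * c⁻¹, h, ?_⟩
  rw [map_mul, map_mul, map_inv, hc'x, hcy]
  rfl

/-- **A `p`-torsion `2`-cocycle of an open subgroup `H ≤ Γ_k` with values in `K̄ˣ` is a
coboundary**, under hypothesis (iv) bis (Serre II §3.1 Prop. 5, (iv) bis ⇒ (ii): the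
`p`-primary component of the Brauer group of every finite separable extension of `k` vanishes;
here at cochain level for Mathlib's continuous cohomology).  See the module docstring for the
architecture of the proof. [cite: SerreGaloisCohomology1997, II §3.1 Prop. 5]
[cite: SerreLocalFields1979, X §7 Prop. 11] -/
theorem exists_d_eq_of_units_cocycle
    (hNorm : ∀ (K L : Type u) [Field K] [Field L] [Algebra k K] [Algebra K L]
      [FiniteDimensional k K] [Algebra.IsSeparable k K] [FiniteDimensional K L] [IsGalois K L],
      Function.Surjective (Algebra.norm K (S := L)))
    {p : ℕ} [hp : Fact p.Prime] (H : Subgroup (absoluteGaloisGroup k))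
    (hH : IsOpen (H : Set (absoluteGaloisGroup k)))
    (a : (homogeneousCochains ((units k).restrict (subgroupIncl H)).toTopRep).X 2)
    (ha : (homogeneousCochains ((units k).restrict (subgroupIncl H)).toTopRep).d 2 3 a = 0)
    (hpa : ((p : ℤ) ^ 1) • a = 0) :
    ∃ b : (homogeneousCochains ((units k).restrict (subgroupIncl H)).toTopRep).X 1,
      (homogeneousCochains ((units k).restrict (subgroupIncl H)).toTopRep).d 1 2 b = a := by
  classical
  haveI := absoluteGaloisGroup_compactSpace k
  haveI : IsClosed (H : Set (absoluteGaloisGroup k)) := Subgroup.isClosed_of_isOpen H hH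
  -- (a) local triviality: `a` dies on every small subgroup
  obtain ⟨V, hV, hVres⟩ := exists_nhds_one_res_two_eq_d ((units k).restrict (subgroupIncl H)) a
  obtain ⟨W, hW, hWV⟩ := (mem_nhds_subtype _ (1 : H) V).1 hV
  obtain ⟨L₁, hfin, hgal, hL₁⟩ := exists_finiteDimensional_isGalois_galFixing_subset (k := k)
    (inter_mem hW (hH.mem_nhds H.one_mem))
  haveI := hfin
  haveI := hgal
  have hL₁H : galFixing k L₁ ≤ H := fun σ hσ => (hL₁ hσ).2
  have hL₁W : (galFixing k L₁ : Set (absoluteGaloisGroup k)) ⊆ W := fun σ hσ => (hL₁ hσ).1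
  -- (b) `H` inside `Gal(L₁/k)` and a Sylow `p`-subgroup of its image
  set A : Subgroup (L₁ ≃ₐ[k] L₁) := H.map (resGal L₁) with hAdef
  have hHA : A.comap (resGal L₁) = H :=
    Subgroup.comap_map_eq_self (by rw [ker_resGal]; exact hL₁H)
  obtain ⟨P₁⟩ := (Sylow.nonempty : Nonempty (Sylow p A))
  set Q : Subgroup (L₁ ≃ₐ[k] L₁) := (P₁ : Subgroup A).map A.subtype with hQdef
  have hQA : Q ≤ A := Subgroup.map_subtype_le _
  have hQp : IsPGroup p Q :=
    P₁.isPGroup'.of_equiv (Subgroup.equivMapOfInjective _ A.subtype A.subtype_injective)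
  -- the subgroups `N_C = Gal(K̄/L₁^C) ≤ H` for `C ≤ Q`
  let NC : Subgroup Q → Subgroup (absoluteGaloisGroup k) := fun C =>
    (C.map Q.subtype).comap (resGal L₁)
  have hNC_le : ∀ C, NC C ≤ H := fun C => by
    rw [← hHA]
    exact Subgroup.comap_mono ((Subgroup.map_subtype_le _).trans hQA)
  have hNC_ker : ∀ C, galFixing k L₁ ≤ NC C := fun C => by
    rw [← ker_resGal]
    exact MonoidHom.ker_le_comap _ _
  -- (c) the descent along the cyclic tower of `Q`
  let Φ : Subgroup Q → Prop := fun C =>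
    ∃ z : (homogeneousCochains ((units k).restrict (subgroupIncl (NC C))).toTopRep).X 1,
      (homogeneousCochains ((units k).restrict (subgroupIncl (NC C))).toTopRep).d 1 2 z =
        (resIncl (units k) (hNC_le C)).f 2 a
  have hΦtop : Φ ⊤ := by
    apply IsPGroup.subgroup_induction hQp Φ
    · -- `Φ ⊥`: `N_⊥ = Gal(K̄/L₁)` is small
      have hbot : NC ⊥ = galFixing k L₁ := by
        change ((⊥ : Subgroup Q).map Q.subtype).comap (resGal L₁) = _
        rw [Subgroup.map_bot, MonoidHom.comap_bot, ker_resGal]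
      have hsub : (((NC ⊥).subgroupOf H : Subgroup H) : Set H) ⊆ V := fun x hx =>
        hWV (hL₁W (by rw [← hbot]; exact hx))
      exact exists_d_eq_incl_of_subgroupOf (units k) (hNC_le ⊥) 1 a (hVres _ hsub)
    · -- the layer `C' ⊲ C` of index `p`
      intro C C' hC'C hnorm hidx hΦC'
      have hDD : C'.map Q.subtype ≤ C.map Q.subtype := Subgroup.map_mono hC'C
      have hn : ((C'.map Q.subtype).subgroupOf (C.map Q.subtype)).Normal :=
        normal_subgroupOf_map Q.subtype hC'C hnorm
      have hindex : (C'.map Q.subtype).relIndex (C.map Q.subtype) = p := by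
        rw [Subgroup.relIndex_map_map_of_injective _ _ Q.subtype_injective]
        exact hidx
      haveI : (layerS L₁ (C.map Q.subtype) (C'.map Q.subtype)).Normal :=
        normal_layerN'_subgroupOf L₁ hDD hn
      set aN := (resIncl (units k) (hNC_le C)).f 2 a with haN
      have haN0 : (homogeneousCochains ((units k).restrict (subgroupIncl (NC C))).toTopRep).d 2 3
          aN = 0 := by
        rw [haN, ← resIncl_d_apply, ha, hom_f_apply_zero]
      have hN'N : NC C' ≤ NC C := Subgroup.comap_mono hDD
      have hres : ∃ z : (homogeneousCochains (((units k).restrict (subgroupIncl (NC C))).restrict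
          (subgroupIncl ((NC C').subgroupOf (NC C)))).toTopRep).X 1,
          (homogeneousCochains (((units k).restrict (subgroupIncl (NC C))).restrict
            (subgroupIncl ((NC C').subgroupOf (NC C)))).toTopRep).d 1 2 z =
          (cochainsMap (subgroupIncl ((NC C').subgroupOf (NC C)))
            (𝟙 (((units k).restrict (subgroupIncl (NC C))).restrict
              (subgroupIncl ((NC C').subgroupOf (NC C)))).toTopRep)).f 2 aN := by
        apply exists_d_eq_subgroupOf_of_incl (units k) hN'N 1 aN
        rw [haN, ← resIncl_comp_apply]
        exact hΦC'
      exact exists_d_eq_of_layer L₁ hDD hn hNorm hindex aN haN0 hres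
  -- (d) from `Gal(K̄/L₁^Q)` (index prime to `p` in `H`) to `H`
  have htop : NC ⊤ = Q.comap (resGal L₁) := by
    change ((⊤ : Subgroup Q).map Q.subtype).comap (resGal L₁) = _
    rw [← MonoidHom.range_eq_map, Subgroup.range_subtype]
  have hSopen : IsOpen (((NC ⊤).subgroupOf H : Subgroup H) : Set H) := by
    change IsOpen ((Subtype.val : H → absoluteGaloisGroup k) ⁻¹'
      (NC ⊤ : Set (absoluteGaloisGroup k)))
    exact (Subgroup.isOpen_mono (hNC_ker ⊤) (isOpen_galFixing k L₁)).preimage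
      continuous_subtype_val
  have hidx : ((NC ⊤).subgroupOf H).index.Coprime p := by
    have h1 : ((NC ⊤).subgroupOf H).index = (P₁ : Subgroup A).index := by
      change (NC ⊤).relIndex H = _
      rw [htop, ← hHA, Subgroup.relIndex_comap,
        Subgroup.map_comap_eq_self_of_surjective (resGal_surjective L₁), hQdef]
      change (((P₁ : Subgroup A).map A.subtype).subgroupOf A).index = _
      rw [← Subgroup.comap_subtype, Subgroup.comap_map_eq_self_of_injective A.subtype_injective]
    rw [h1]
    exact ((Nat.Prime.coprime_iff_not_dvd hp.out).2 P₁.not_dvd_index).symm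
  have hres₁ := exists_d_eq_subgroupOf_of_incl (units k) (hNC_le ⊤) 1 a hΦtop
  exact exists_d_eq_of_res_eq_d_of_psmul_eq_zero ((units k).restrict (subgroupIncl H)) hSopen
    hidx 1 a ha hres₁ hpa

set_option synthInstance.maxHeartbeats 200000 in
/-- **`H²(Gal(K̄/F), μ_p) = 0` for every open subgroup of `Γ_k`, under hypothesis (iv) bis**
(Serre II §3.1 Prop. 5, (iv) bis ⇒ (i) for the module `μ_p`; `p` any prime, the sequence
degenerating when `p = char k`): a `2`-cocycle `c` of `μ_p` maps to a `p`-torsion cocycle of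
`K̄ˣ`, a coboundary by `exists_d_eq_of_units_cocycle`, and comes back through the Kummer sequence
`0 → μ_p → K̄ˣ → K̄ˣ → 0` and Hilbert 90 for `H = Gal(K̄/F)` (`IsSES.exists_d_eq_of_map_two`,
`subsingleton_one_units_galFixing`). [cite: SerreGaloisCohomology1997, II §3.1 Prop. 5]
[cite: SerreGaloisCohomology1997, II §1.2] -/
theorem subsingleton_two_mu_of_norm_surjective
    (hNorm : ∀ (K L : Type u) [Field K] [Field L] [Algebra k K] [Algebra K L]
      [FiniteDimensional k K] [Algebra.IsSeparable k K] [FiniteDimensional K L] [IsGalois K L],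
      Function.Surjective (Algebra.norm K (S := L)))
    {p : ℕ} [hp : Fact p.Prime] (H : Subgroup (absoluteGaloisGroup k))
    (hH : IsOpen (H : Set (absoluteGaloisGroup k))) :
    Subsingleton (continuousCohomology 2 ((mu k p).restrict (subgroupIncl H)).toTopRep) := by
  classical
  haveI := absoluteGaloisGroup_compactSpace k
  haveI : IsClosed (H : Set (absoluteGaloisGroup k)) := Subgroup.isClosed_of_isOpen H hH
  -- Hilbert 90 for `H = Gal(K̄/F)`
  have h90 : Subsingleton
      (continuousCohomology 1 ((units k).restrict (subgroupIncl H)).toTopRep) := by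
    obtain ⟨F, _, hF⟩ := exists_galFixing_eq_of_isOpen H hH
    subst hF
    exact subsingleton_one_units_galFixing F
  have hS : IsSES (resModHom H (kummerι k p)) (resModHom H (kummerπ k p)) :=
    (isSES_kummer k p hp.out.pos).res H
  refine (subsingleton_homology_succ_iff _ 1).2 fun c hc => ?_
  have hc2 : (homogeneousCochains ((mu k p).restrict (subgroupIncl H)).toTopRep).d 2 3 c = 0 := hc
  set a := (cochainsHom (resModHom H (kummerι k p))).f 2 c with hadef
  have ha : (homogeneousCochains ((units k).restrict (subgroupIncl H)).toTopRep).d 2 3 a = 0 := by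
    rw [hadef, hom_f_d_apply (cochainsHom (resModHom H (kummerι k p))) 2 3 c, hc2, hom_f_apply_zero]
  have hpa : ((p : ℤ) ^ 1) • a = 0 := by
    rw [hadef, ← map_zsmul ((cochainsHom (resModHom H (kummerι k p))).f 2).hom ((p : ℤ) ^ 1) c]
    change (cochainsHom (resModHom H (kummerι k p))).f 2 (((p : ℤ) ^ 1) • c) = 0
    rw [psmul_cochain_mu_eq_zero k p (subgroupIncl H) 2 c, hom_f_apply_zero]
  obtain ⟨e, he⟩ := hS.exists_d_eq_of_map_two h90 c
    (exists_d_eq_of_units_cocycle hNorm H hH a ha hpa)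
  exact ⟨e, he⟩

end Literature.NumberTheory.GaloisRepresentations

end
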